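import Summits.BirchSwinnertonDyer.BirchSwinnertonDyer.Theorems.CyclotomicUntwistFormalLogBoundedIffDivisible
import Literature.NumberTheory.EllipticCurves.CMSigmaSqIntegralityProofs
import Literature.NumberTheory.EllipticCurves.FormalGroupLawAxiomsUniversalProofs
import Literature.NumberTheory.EllipticCurves.FormalGroupFrobeniusTypeProofs
import Literature.RingTheory.FormalGroups.HondaTypeUniqueness
import HarnessLib

/-!
# Route `CyclotomicUntwist`: RANK ≤ 2 OF KATZ'S DIEUDONNÉ MODULE OVER `ℤ_p`, ASSEMBLED FROM HONDA'S FUNCTIONAL EQUATION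
# AND THE ENDOMORPHISMS OF THE REDUCED FORMAL GROUP (the binder `H3` of the elementary route to `katz_dieudonne_rank_le_two`)

Cell `pub/bsd-wall` (D-0145 line `route-BirchSwinnertonDyer-CyclotomicUntwist` rev 9), K1 LEAD seat `bsd-line-cycu-p1` (gen 6).
THEOREMS ONLY (no definition, no named fact, no instance, no notation, no `sorry`); helper `--supports` the crux K1 =
stmt-BirchSwinnertonDyer-21580 (`PSRankOneLowerHalfAtThree`; serves K2 = 21581 equally), registered stub S2k
`stub_KATZ_rankLeTwo_supersingular` of `Lines/dfrob_wan.lean` v3 via cycu-p4's assembly W4. BSD is not proved by this file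
and no crux is.

## What is proved (memo `Cruxes/PSRankOneLowerHalfAtThree/KATZ-FROBENIUS-MOD-VARPI-v2.md` §2, steps (i) ⟶ (iii) ⟶ conclusion)

For a Weierstrass equation `V/ℤ_p` (`p` odd) with elliptic generic and special fibres, `W = V ⊗ ℚ_p`, `F` its formal
group law, `log_W` its logarithm, `[c] := exp_W(c·log_W)` (`c ∈ ℤ_p`; integral by `isPadicInt_formalExp_subst_C_mul_formalLog`):
* §0 `formalLog_subst_pair` (`log_W F(P,Q) = log_W P + log_W Q` for multivariate `P, Q`), `eq_of_formalLog_subst_eq`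
  (`log_W` is injective on series without constant term), `formalLog_subst_pair_zmul_expand`
  (`log_W F([A]X, [B](Xᵖ)) = A·log_W + B·log_W(Xᵖ)`);
* §1 `isPadicInt_inv_mul_formalLog_subst_sub`: `h ≡ h₁ (mod p)` integral without constant term ⟹
  `log_W h ≡ log_W h₁ (mod p)` (Katz's Key Lemma over `ℤ_p`, tree: `norm_coeff_subst_sub_subst_le_of_natCast_mul_coeff_le`);
* §2 **`isPadicInt_inv_mul_hom_defect` / `map_toZMod_subst_formalGroupLaw`**: if `log_W(h) = pᵏ·g` with `h ∈ Xℤ_p⟦X⟧` and the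
  coboundary `g(F) − g(X) − g(Y)` has bounded denominators, then `h(F(X,Y)) ≡ F(h(X),h(Y)) (mod p)` — the reduction `h̄` is an
  ENDOMORPHISM of `F̄ = F ⊗ 𝔽_p` (formal difference `γ = F(h(F), i(F(hX,hY)))` has `log_W γ = pᵏ·∂g` bounded ⟹ `p ∣ γ` by
  cycu-p4's Lemma Λ `FormalLogDivisibility.isPadicInt_inv_mul_of_isPadicInt_pow_mul_formalLog_subst` ⟹ `h(F) = F(γ, ·) ≡ F(0, ·)`);
* §3 **`padicRankTwo_of_honda_of_endomorphisms`**: GRANTED, per curve, (W1) HONDA «every second-kind `g` has `pᵏg = log_W h`,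
  `h ∈ Xℤ_p⟦X⟧`» and (W3) «every `H ∈ Xℤ_p⟦X⟧` with `H̄ ∈ End(F̄)` is `≡ F([A]X, [B](Xᵖ)) (mod p)` for some `A, B ∈ ℤ_p`»
  (`End_{𝔽_p⟦X⟧}(F̄) = ℤ_p ⊕ ℤ_p·π`, cycu-p3's W3), THEN every second-kind `g` is `≡ a·log_W + b·log_W(Xᵖ)` modulo a series with
  `p`-power-bounded denominators (`a, b ∈ ℚ_p`) — cycu-p4's binder `H3` («rank `D(Ŵ/ℤ_p) ⊗ ℚ ≤ 2`», Katz 1981 Thm 5.3.3 over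
  `ℤ_p`, elementary), which his W4 transports to `𝓞_{ℚ₃(ζ₉)}` and to the Literature fact `katz_dieudonne_rank_le_two`.

References: Katz 1981 §5 [Katz1981CrystallineDieudonne]; Honda 1970 Thm. 2 [Honda1970]; Hazewinkel 1978 I §2.3 [Hazewinkel1978];
Silverman AEC IV.2–IV.6 [SilvermanAEC2009].
-/

-- single-conjunct summit: `Summit.BirchSwinnertonDyer.BirchSwinnertonDyer.…` repeats the name by design
set_option linter.dupNamespace false
set_option autoImplicit false

noncomputable section

open PowerSeries WeierstrassCurve Literature.NumberTheory.EllipticCurves Literature.RingTheory.FormalGroups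

namespace Summit.BirchSwinnertonDyer.BirchSwinnertonDyer.Theorems.PadicRankTwoAssembly

variable {p : ℕ} [hp : Fact p.Prime]

/-! ## §0 Logarithmic calculus on the `ℚ_p`-model -/

section LogCalculus

variable (W : WeierstrassCurve ℚ_[p])

/-- `log_W(F(P, Q)) = log_W P + log_W Q` for series `P, Q` (any number of variables) without constant term.
[cite: SilvermanAEC2009, IV.5.2] -/
theorem formalLog_subst_pair {τ : Type*} {P Q : MvPowerSeries τ ℚ_[p]} (hP : MvPowerSeries.constantCoeff P = 0)
    (hQ : MvPowerSeries.constantCoeff Q = 0) :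
    W.formalLog.subst (MvPowerSeries.subst ![P, Q] W.formalGroupLaw) = W.formalLog.subst P + W.formalLog.subst Q := by
  have hS : MvPowerSeries.constantCoeff (W.formalLog.subst P + W.formalLog.subst Q) = 0 := by
    rw [map_add, constantCoeff_powerSeries_subst_eq_zero hP W.constantCoeff_formalLog,
      constantCoeff_powerSeries_subst_eq_zero hQ W.constantCoeff_formalLog, add_zero]
  rw [W.subst_pair_formalGroupLaw_eq hP hQ, ← subst_comp_subst_apply
    (HasSubst.of_constantCoeff_zero' W.constantCoeff_formalExp) (HasSubst.of_constantCoeff_zero hS),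
    W.formalLog_subst_formalExp, subst_X (HasSubst.of_constantCoeff_zero hS)]

/-- `log_W` is injective on series without constant term: `log_W Z₁ = log_W Z₂ ⟹ Z₁ = Z₂` (apply `exp_W`). [folklore] -/
theorem eq_of_formalLog_subst_eq {τ : Type*} {Z₁ Z₂ : MvPowerSeries τ ℚ_[p]} (h₁ : MvPowerSeries.constantCoeff Z₁ = 0)
    (h₂ : MvPowerSeries.constantCoeff Z₂ = 0) (h : W.formalLog.subst Z₁ = W.formalLog.subst Z₂) : Z₁ = Z₂ := by
  have e : ∀ {Z : MvPowerSeries τ ℚ_[p]}, MvPowerSeries.constantCoeff Z = 0 →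
      W.formalExp.subst (W.formalLog.subst Z) = Z := fun {Z} hZ => by
    rw [← subst_comp_subst_apply (HasSubst.of_constantCoeff_zero' W.constantCoeff_formalLog)
      (HasSubst.of_constantCoeff_zero hZ), W.formalExp_subst_formalLog, subst_X (HasSubst.of_constantCoeff_zero hZ)]
  rw [← e h₁, h, e h₂]

/-- `log_W([A] z) = A·log_W z` and `log_W([B](zᵖ)) = B·log_W(zᵖ)`, hence
`log_W(F([A] z, [B](zᵖ))) = A·log_W + B·log_W(zᵖ)` (`[c] = exp_W(c·log_W)`). [cite: SilvermanAEC2009, IV.5.6] -/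
theorem formalLog_subst_pair_zmul_expand (A B : ℚ_[p]) :
    W.formalLog.subst (MvPowerSeries.subst ![W.formalExp.subst (C A * W.formalLog),
        expand p hp.out.ne_zero (W.formalExp.subst (C B * W.formalLog))] W.formalGroupLaw) =
      C A * W.formalLog + C B * expand p hp.out.ne_zero W.formalLog := by
  have hA0 : constantCoeff (W.formalExp.subst (C A * W.formalLog)) = 0 :=
    W.constantCoeff_formalExp_subst_C_mul_formalLog A
  have hB0 : constantCoeff (expand p hp.out.ne_zero (W.formalExp.subst (C B * W.formalLog))) = 0 := by
    rw [constantCoeff_expand]; exact W.constantCoeff_formalExp_subst_C_mul_formalLog B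
  rw [formalLog_subst_pair W hA0 hB0]
  change W.formalLog.subst (W.formalExp.subst (C A * W.formalLog)) +
    W.formalLog.subst (expand p hp.out.ne_zero (W.formalExp.subst (C B * W.formalLog))) = _
  rw [← expand_subst' hp.out.ne_zero (HasSubst.of_constantCoeff_zero' (W.constantCoeff_formalExp_subst_C_mul_formalLog B)),
    W.formalLog_subst_formalExp_subst_C_mul_formalLog, W.formalLog_subst_formalExp_subst_C_mul_formalLog, map_mul,
    expand_C]

end LogCalculus

/-! ## §1 `log(h) ≡ log(h₁) (mod p)` for integral `h ≡ h₁ (mod p)` (Katz's Key Lemma over `ℤ_p`) -/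

section Congruence

variable (W : WeierstrassCurve ℚ_[p]) [hW : W.IsIntegral ℤ_[p]]

/-- `‖p⁻¹·c‖ ≤ 1 ↔ ‖c‖ ≤ p⁻¹` in `ℚ_p`. [folklore] -/
theorem norm_inv_mul_le_one_iff (c : ℚ_[p]) : ‖(p : ℚ_[p])⁻¹ * c‖ ≤ 1 ↔ ‖c‖ ≤ (p : ℝ)⁻¹ := by
  rw [norm_mul, norm_inv, Padic.norm_p, inv_inv, ← one_div, le_div_iff₀' (by exact_mod_cast hp.out.pos : (0 : ℝ) < p)]

/-- **`log_W(h) ≡ log_W(h₁) (mod pℤ_p⟦X⟧)`** for `p`-integral `h ≡ h₁ (mod p)` without constant term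
(`n·[Xⁿ]log_W ∈ ℤ_p` absorbs the denominators: `hᵐ − h₁ᵐ ∈ mpℤ_p⟦X⟧`).
[cite: Katz1981CrystallineDieudonne, §5 Key Lemma 5.1.3] [cite: Honda1970, Lemma 2.3] -/
theorem isPadicInt_inv_mul_formalLog_subst_sub {h h₁ : ℚ_[p]⟦X⟧} (h0 : constantCoeff h = 0)
    (hint : IsPadicInt h) (h₁0 : constantCoeff h₁ = 0) (hint₁ : IsPadicInt h₁)
    (hc : IsPadicInt (C (p : ℚ_[p])⁻¹ * (h - h₁))) :
    IsPadicInt (C (p : ℚ_[p])⁻¹ * (W.formalLog.subst h - W.formalLog.subst h₁)) := by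
  rw [isPadicInt_iff_coeff] at hint hint₁ hc ⊢
  intro n
  rw [coeff_C_mul, norm_inv_mul_le_one_iff]
  exact norm_coeff_subst_sub_subst_le_of_natCast_mul_coeff_le W.norm_natCast_mul_coeff_formalLog_le h0 hint
    h₁0 hint₁ (fun m => (norm_inv_mul_le_one_iff _).mp (by rw [← coeff_C_mul]; exact hc m)) n

end Congruence

/-- Both entries of a pair of integral series are integral. [folklore] -/
theorem isPadicInt_pair {τ : Type*} {a b : MvPowerSeries τ ℚ_[p]} (ha : IsPadicInt a) (hb : IsPadicInt b) :
    ∀ s : Fin 2, IsPadicInt (![a, b] s) := fun s => by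
  fin_cases s <;> [exact ha; exact hb]

/-- Both entries of a pair of series without constant term have no constant term. [folklore] -/
theorem constantCoeff_pair {R : Type*} [CommRing R] {τ : Type*} {a b : MvPowerSeries τ R}
    (ha : MvPowerSeries.constantCoeff a = 0) (hb : MvPowerSeries.constantCoeff b = 0) :
    ∀ s : Fin 2, MvPowerSeries.constantCoeff (![a, b] s) = 0 := fun s => by
  fin_cases s <;> [exact ha; exact hb]

/-! ## §2 From `pᵏg = log_W(h)` to `h̄ ∈ End(Ê ⊗ 𝔽_p)` (Lemma Λ) -/

section Endomorphism

variable (V : WeierstrassCurve ℤ_[p]) [hE : (V.map PadicInt.Coe.ringHom).IsElliptic]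
  [hEt : (V.map PadicInt.toZMod).IsElliptic]

/-- **If `log_W(h) = pᵏ·g` with `h ∈ Xℤ_p⟦X⟧` and `g` of the second kind (coboundary with bounded denominators),
then `h(F(X,Y)) ≡ F(h(X), h(Y)) (mod p)`** — i.e. `h̄` is an endomorphism of the reduced formal group. With
`u = h(F)`, `v = F(h(X),h(Y))` and the formal difference `γ = F(u, i(v))`: `log_W γ = log_W u − log_W v =
pᵏ·(g(F) − g(X) − g(Y))` has bounded denominators, so `p ∣ γ` by Lemma Λ
(`FormalLogDivisibility.isPadicInt_inv_mul_of_isPadicInt_pow_mul_formalLog_subst`), and `u = F(γ, v) ≡ F(0, v) = v`.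
[cite: Katz1981CrystallineDieudonne, §5 (5.1.3)–(5.3.3)] [cite: Honda1970, Thm. 2] -/
theorem isPadicInt_inv_mul_hom_defect (hp2 : p ≠ 2) {g h : ℚ_[p]⟦X⟧} (h0 : constantCoeff h = 0)
    (hint : IsPadicInt h) {k d' : ℕ}
    (hℓh : (V.map PadicInt.Coe.ringHom).formalLog.subst h = C ((p : ℚ_[p]) ^ k) * g)
    (hcob : ∀ e : Fin 2 →₀ ℕ, ‖(p : ℚ_[p]) ^ d' * MvPowerSeries.coeff e
      (g.subst (V.map PadicInt.Coe.ringHom).formalGroupLaw - g.subst (MvPowerSeries.X 0) -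
        g.subst (MvPowerSeries.X 1))‖ ≤ 1) :
    IsPadicInt (MvPowerSeries.C (p : ℚ_[p])⁻¹ *
      (h.subst (V.map PadicInt.Coe.ringHom).formalGroupLaw -
        MvPowerSeries.subst ![h.subst (MvPowerSeries.X 0 : MvPowerSeries (Fin 2) ℚ_[p]),
          h.subst (MvPowerSeries.X 1 : MvPowerSeries (Fin 2) ℚ_[p])] (V.map PadicInt.Coe.ringHom).formalGroupLaw)) := by
  set W := V.map (PadicInt.Coe.ringHom (p := p)) with hWdef
  haveI : W.IsIntegral ℤ_[p] := ⟨⟨V, rfl⟩⟩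
  set F := W.formalGroupLaw with hF
  set ℓ := W.formalLog with hℓ
  have hp0 : (p : ℚ_[p]) ≠ 0 := by exact_mod_cast hp.out.ne_zero
  have hF0 : MvPowerSeries.constantCoeff F = 0 := W.constantCoeff_formalGroupLaw
  have hFi : IsPadicInt F := W.isPadicInt_formalGroupLaw
  -- `g(0) = 0`
  have hg0 : constantCoeff g = 0 := by
    have := congrArg constantCoeff hℓh
    rw [Literature.RingTheory.FormalGroups.constantCoeff_subst_of_constantCoeff_eq_zero h0, map_mul,
      constantCoeff_C] at this
    exact (mul_eq_zero.mp this.symm).resolve_left (pow_ne_zero _ hp0)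
  -- the players `u = h(F)`, `v = F(h(X), h(Y))`, `i(v)`, `γ = F(u, i(v))`
  set u : MvPowerSeries (Fin 2) ℚ_[p] := h.subst F with hu
  have hu0 : MvPowerSeries.constantCoeff u = 0 := constantCoeff_powerSeries_subst_eq_zero hF0 h0
  have hui : IsPadicInt u := hint.powerSeries_subst hFi (HasSubst.of_constantCoeff_zero hF0)
  have hX0 : MvPowerSeries.constantCoeff (h.subst (MvPowerSeries.X 0 : MvPowerSeries (Fin 2) ℚ_[p])) = 0 :=
    constantCoeff_powerSeries_subst_eq_zero (MvPowerSeries.constantCoeff_X 0) h0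
  have hX1 : MvPowerSeries.constantCoeff (h.subst (MvPowerSeries.X 1 : MvPowerSeries (Fin 2) ℚ_[p])) = 0 :=
    constantCoeff_powerSeries_subst_eq_zero (MvPowerSeries.constantCoeff_X 1) h0
  have hX0i : IsPadicInt (h.subst (MvPowerSeries.X 0 : MvPowerSeries (Fin 2) ℚ_[p])) :=
    hint.powerSeries_subst (IsPadicInt.X 0) (HasSubst.of_constantCoeff_zero (MvPowerSeries.constantCoeff_X 0))
  have hX1i : IsPadicInt (h.subst (MvPowerSeries.X 1 : MvPowerSeries (Fin 2) ℚ_[p])) :=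
    hint.powerSeries_subst (IsPadicInt.X 1) (HasSubst.of_constantCoeff_zero (MvPowerSeries.constantCoeff_X 1))
  set v : MvPowerSeries (Fin 2) ℚ_[p] := MvPowerSeries.subst ![h.subst (MvPowerSeries.X 0 : MvPowerSeries (Fin 2) ℚ_[p]),
    h.subst (MvPowerSeries.X 1 : MvPowerSeries (Fin 2) ℚ_[p])] F with hv
  have hv0 : MvPowerSeries.constantCoeff v = 0 :=
    MvPowerSeries.constantCoeff_subst_eq_zero (hasSubst_pair hX0 hX1) (constantCoeff_pair hX0 hX1) hF0
  have hvi : IsPadicInt v := hFi.subst (isPadicInt_pair hX0i hX1i) (hasSubst_pair hX0 hX1)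
  set nv : MvPowerSeries (Fin 2) ℚ_[p] := W.formalNeg.subst v with hnv
  have hnv0 : MvPowerSeries.constantCoeff nv = 0 := constantCoeff_powerSeries_subst_eq_zero hv0 W.constantCoeff_formalNeg
  have hnvi : IsPadicInt nv := W.isPadicInt_formalNeg.powerSeries_subst hvi (HasSubst.of_constantCoeff_zero hv0)
  set γ : MvPowerSeries (Fin 2) ℚ_[p] := MvPowerSeries.subst ![u, nv] F with hγ
  have hγ0 : MvPowerSeries.constantCoeff γ = 0 :=
    MvPowerSeries.constantCoeff_subst_eq_zero (hasSubst_pair hu0 hnv0) (constantCoeff_pair hu0 hnv0) hF0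
  have hγi : IsPadicInt γ := hFi.subst (isPadicInt_pair hui hnvi) (hasSubst_pair hu0 hnv0)
  -- `log(h(Z)) = pᵏ g(Z)`
  have hℓhZ : ∀ {Z : MvPowerSeries (Fin 2) ℚ_[p]}, MvPowerSeries.constantCoeff Z = 0 →
      ℓ.subst (h.subst Z) = (p : ℚ_[p]) ^ k • g.subst Z := fun {Z} hZ => by
    rw [← subst_comp_subst_apply (HasSubst.of_constantCoeff_zero' h0) (HasSubst.of_constantCoeff_zero hZ), hℓh,
      ← smul_eq_C_mul, subst_smul (HasSubst.of_constantCoeff_zero hZ)]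
  -- `log γ = log u − log v = pᵏ·(coboundary of g)`
  have hℓv : ℓ.subst v = (p : ℚ_[p]) ^ k • (g.subst (MvPowerSeries.X 0 : MvPowerSeries (Fin 2) ℚ_[p]) +
      g.subst (MvPowerSeries.X 1 : MvPowerSeries (Fin 2) ℚ_[p])) := by
    rw [hv, formalLog_subst_pair W hX0 hX1, hℓhZ (MvPowerSeries.constantCoeff_X 0), hℓhZ (MvPowerSeries.constantCoeff_X 1),
      smul_add]
  have hℓnv : ℓ.subst nv = -ℓ.subst v := by
    rw [hnv, ← subst_comp_subst_apply (HasSubst.of_constantCoeff_zero' W.constantCoeff_formalNeg)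
      (HasSubst.of_constantCoeff_zero hv0), W.formalLog_subst_formalNeg, ← coe_substAlgHom
      (HasSubst.of_constantCoeff_zero hv0), map_neg]
  have hℓγ : ℓ.subst γ = (p : ℚ_[p]) ^ k • (g.subst F - g.subst (MvPowerSeries.X 0) - g.subst (MvPowerSeries.X 1)) := by
    rw [hγ, formalLog_subst_pair W hu0 hnv0, hℓnv, hu, hℓhZ hF0, hℓv, smul_sub, smul_sub, smul_add]
    ring
  -- Lemma Λ: `p ∣ γ`
  have hΛ : IsPadicInt (MvPowerSeries.C ((p : ℚ_[p]) ^ d') * ℓ.subst γ) := by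
    intro e
    rw [hℓγ, MvPowerSeries.smul_eq_C_mul, ← mul_assoc, ← map_mul, MvPowerSeries.coeff_C_mul,
      mul_comm ((p : ℚ_[p]) ^ d'), mul_assoc, norm_mul]
    have hpk : ‖(p : ℚ_[p]) ^ k‖ ≤ 1 := by
      rw [norm_pow, Padic.norm_p]
      exact pow_le_one₀ (by positivity) (inv_le_one_of_one_le₀ (by exact_mod_cast hp.out.one_le))
    exact mul_le_one₀ hpk (norm_nonneg _) (hcob e)
  have hpγ : IsPadicInt (MvPowerSeries.C (p : ℚ_[p])⁻¹ * γ) :=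
    FormalLogDivisibility.isPadicInt_inv_mul_of_isPadicInt_pow_mul_formalLog_subst V hp2 hγi hγ0 hΛ
  -- `u = F(γ, v)` and `v = F(0, v)` (compare logarithms)
  have huγ : u = MvPowerSeries.subst ![γ, v] F := by
    refine eq_of_formalLog_subst_eq W hu0 (MvPowerSeries.constantCoeff_subst_eq_zero (hasSubst_pair hγ0 hv0)
      (constantCoeff_pair hγ0 hv0) hF0) ?_
    rw [formalLog_subst_pair W hγ0 hv0, hγ, formalLog_subst_pair W hu0 hnv0, hℓnv]
    ring
  have hv' : v = MvPowerSeries.subst ![(0 : MvPowerSeries (Fin 2) ℚ_[p]), v] F := by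
    refine eq_of_formalLog_subst_eq W hv0 (MvPowerSeries.constantCoeff_subst_eq_zero (hasSubst_pair (map_zero _) hv0)
      (constantCoeff_pair (map_zero _) hv0) hF0) ?_
    rw [formalLog_subst_pair W (map_zero _) hv0, subst_zero_of_constantCoeff_zero W.constantCoeff_formalLog, zero_add]
  -- reduce modulo `p`: lift `γ, v` to `ℤ_p⟦X,Y⟧`
  obtain ⟨Γ, hΓ⟩ := isPadicInt_iff_exists_map.mp hγi
  obtain ⟨Vv, hVv⟩ := isPadicInt_iff_exists_map.mp hvi
  have hcc : ∀ {Z : MvPowerSeries (Fin 2) ℤ_[p]} {z : MvPowerSeries (Fin 2) ℚ_[p]}, Z.map PadicInt.Coe.ringHom = z →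
      MvPowerSeries.constantCoeff z = 0 → MvPowerSeries.constantCoeff Z = 0 := fun {Z z} hZ hz => by
    apply (PadicInt.coe_eq_zero).mp
    have := congrArg MvPowerSeries.constantCoeff hZ
    rwa [MvPowerSeries.constantCoeff_map, hz] at this
  have hΓ0 : MvPowerSeries.constantCoeff Γ = 0 := hcc hΓ hγ0
  have hVv0 : MvPowerSeries.constantCoeff Vv = 0 := hcc hVv hv0
  have hΓbar : Γ.map (PadicInt.toZMod (p := p)) = 0 :=
    FormalLogDivisibility.map_toZMod_eq_zero_of_isPadicInt_inv_mul Γ (by rw [hΓ]; exact hpγ)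
  set D : MvPowerSeries (Fin 2) ℤ_[p] := MvPowerSeries.subst ![Γ, Vv] V.formalGroupLaw -
    MvPowerSeries.subst ![0, Vv] V.formalGroupLaw with hD
  have hDmap : D.map (PadicInt.Coe.ringHom (p := p)) = u - v := by
    rw [hD, map_sub, map_subst_pair_formalGroupLaw V _ hΓ0 hVv0, map_subst_pair_formalGroupLaw V _ (map_zero _) hVv0,
      hΓ, hVv, map_zero, ← hWdef, ← hF, ← huγ, ← hv']
  have hDbar : D.map (PadicInt.toZMod (p := p)) = 0 := by
    rw [hD, map_sub, map_subst_pair_formalGroupLaw V _ hΓ0 hVv0, map_subst_pair_formalGroupLaw V _ (map_zero _) hVv0,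
      hΓbar, map_zero, sub_self]
  have := FormalLogDivisibility.isPadicInt_inv_mul_of_map_toZMod_eq_zero D hDbar
  rwa [hDmap] at this

/-- Pushing a ring map through the homomorphism defect `H(F(X,Y)) − F(H(X), H(Y))`. [folklore] -/
theorem map_hom_defect {R S : Type*} [CommRing R] [CommRing S] (U : WeierstrassCurve R) (φ : R →+* S)
    {H : R⟦X⟧} (hH0 : constantCoeff H = 0) :
    MvPowerSeries.map φ (H.subst U.formalGroupLaw -
      MvPowerSeries.subst ![H.subst (MvPowerSeries.X 0 : MvPowerSeries (Fin 2) R),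
        H.subst (MvPowerSeries.X 1 : MvPowerSeries (Fin 2) R)] U.formalGroupLaw) =
      (H.map φ).subst (U.map φ).formalGroupLaw -
        MvPowerSeries.subst ![(H.map φ).subst (MvPowerSeries.X 0 : MvPowerSeries (Fin 2) S),
          (H.map φ).subst (MvPowerSeries.X 1 : MvPowerSeries (Fin 2) S)] (U.map φ).formalGroupLaw := by
  have hHX : ∀ i : Fin 2, MvPowerSeries.constantCoeff (H.subst (MvPowerSeries.X i : MvPowerSeries (Fin 2) R)) = 0 :=
    fun i => constantCoeff_powerSeries_subst_eq_zero (MvPowerSeries.constantCoeff_X i) hH0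
  have hmapX : ∀ i : Fin 2, MvPowerSeries.map φ (H.subst (MvPowerSeries.X i : MvPowerSeries (Fin 2) R)) =
      (H.map φ).subst (MvPowerSeries.X i : MvPowerSeries (Fin 2) S) := fun i => by
    rw [PowerSeries.map_subst (HasSubst.of_constantCoeff_zero (MvPowerSeries.constantCoeff_X i)), MvPowerSeries.map_X]
  rw [map_sub, PowerSeries.map_subst U.hasSubst_formalGroupLaw, map_formalGroupLaw,
    map_subst_pair_formalGroupLaw U φ (hHX 0) (hHX 1), hmapX 0, hmapX 1]

/-- **The endomorphism, in characteristic `p`.** Under the hypotheses of `isPadicInt_inv_mul_hom_defect`, the reduction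
`h̄ ∈ 𝔽_p⟦X⟧` of `h = H ⊗ ℚ_p` satisfies `h̄(F̄(X,Y)) = F̄(h̄(X), h̄(Y))` for the reduced formal group law `F̄` of
`V ⊗ 𝔽_p`. [cite: Katz1981CrystallineDieudonne, §5] -/
theorem map_toZMod_subst_formalGroupLaw (hp2 : p ≠ 2) {g : ℚ_[p]⟦X⟧} {H : ℤ_[p]⟦X⟧} (hH0 : constantCoeff H = 0)
    {k d' : ℕ}
    (hℓh : (V.map PadicInt.Coe.ringHom).formalLog.subst (H.map PadicInt.Coe.ringHom) = C ((p : ℚ_[p]) ^ k) * g)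
    (hcob : ∀ e : Fin 2 →₀ ℕ, ‖(p : ℚ_[p]) ^ d' * MvPowerSeries.coeff e
      (g.subst (V.map PadicInt.Coe.ringHom).formalGroupLaw - g.subst (MvPowerSeries.X 0) -
        g.subst (MvPowerSeries.X 1))‖ ≤ 1) :
    (H.map PadicInt.toZMod).subst (V.map PadicInt.toZMod).formalGroupLaw =
      MvPowerSeries.subst ![(H.map PadicInt.toZMod).subst (MvPowerSeries.X 0 : MvPowerSeries (Fin 2) (ZMod p)),
        (H.map PadicInt.toZMod).subst (MvPowerSeries.X 1 : MvPowerSeries (Fin 2) (ZMod p))]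
        (V.map PadicInt.toZMod).formalGroupLaw := by
  set h := H.map (PadicInt.Coe.ringHom (p := p)) with hh
  have h0 : constantCoeff h = 0 := by
    rw [hh, ← coeff_zero_eq_constantCoeff_apply, coeff_map, coeff_zero_eq_constantCoeff_apply, hH0, map_zero]
  have hint : IsPadicInt h := isPadicInt_map H
  have key := isPadicInt_inv_mul_hom_defect V hp2 h0 hint hℓh hcob
  set D : MvPowerSeries (Fin 2) ℤ_[p] := H.subst V.formalGroupLaw -
    MvPowerSeries.subst ![H.subst (MvPowerSeries.X 0 : MvPowerSeries (Fin 2) ℤ_[p]),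
      H.subst (MvPowerSeries.X 1 : MvPowerSeries (Fin 2) ℤ_[p])] V.formalGroupLaw with hD
  have hDbar : D.map (PadicInt.toZMod (p := p)) = 0 :=
    FormalLogDivisibility.map_toZMod_eq_zero_of_isPadicInt_inv_mul D (by rw [hD, map_hom_defect V _ hH0]; exact key)
  rw [hD, map_hom_defect V _ hH0] at hDbar
  exact sub_eq_zero.mp hDbar

end Endomorphism

/-! ## §3 The assembly: `pᵏ g = log(h)`, `h̄ = [A] ⊕ [B]π` ⟹ `g ≡ p⁻ᵏ(A·log + B·log(Xᵖ))` mod bounded -/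

section Assembly

variable (V : WeierstrassCurve ℤ_[p]) [hE : (V.map PadicInt.Coe.ringHom).IsElliptic]
  [hEt : (V.map PadicInt.toZMod).IsElliptic]

/-- **RANK ≤ 2 OF KATZ'S DIEUDONNÉ MODULE OVER `ℤ_p`, ASSEMBLED** (the binder `H3` of the `CyclotomicUntwist`
programme, per curve). For a Weierstrass equation `V/ℤ_p` (`p` odd) with elliptic generic and special fibres,
GRANTED (W1) *Honda*: every second-kind `g` (`g(0) = 0`, `dg` and the coboundary `g(F(X,Y)) − g(X) − g(Y)` with bounded
denominators) has `pᵏg = log_W(h)` for some `k` and some `h ∈ Xℤ_p⟦X⟧`; and (W3) *endomorphisms of the reduction*: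
every `H ∈ Xℤ_p⟦X⟧` whose reduction `H̄` is an endomorphism of the reduced formal group `F̄` is congruent modulo `p`
to `F([A]X, [B](Xᵖ))` for some `A, B ∈ ℤ_p` (`[c] = exp_W(c·log_W)`; i.e. `End_{𝔽_p⟦X⟧}(F̄) = ℤ_p ⊕ ℤ_p·π`) —
THEN every second-kind `g` satisfies `g ≡ a·log_W + b·log_W(Xᵖ)` modulo a series with `p`-power-bounded
denominators, for some `a, b ∈ ℚ_p`. Proof: `pᵏg = log_W h` (W1); `h̄ ∈ End(F̄)` (`map_toZMod_subst_formalGroupLaw`,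
Lemma Λ); `h ≡ h₁ := F([A]X,[B](Xᵖ)) (mod p)` (W3); `log_W h ≡ log_W h₁ = A·log_W + B·log_W(Xᵖ) (mod p)` (Key Lemma
over `ℤ_p`); divide by `pᵏ`. [cite: Katz1981CrystallineDieudonne, Thm. 5.3.3] [cite: Honda1970, Thm. 2]
[cite: Hazewinkel1978, Ch. I §2.3] -/
theorem padicRankTwo_of_honda_of_endomorphisms (hp2 : p ≠ 2)
    (hW1 : ∀ g : ℚ_[p]⟦X⟧, constantCoeff g = 0 →
      (∃ d : ℕ, ∀ n : ℕ, ‖(p : ℚ_[p]) ^ d * ((n : ℚ_[p]) * coeff n g)‖ ≤ 1) →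
      (∃ d' : ℕ, ∀ e : Fin 2 →₀ ℕ, ‖(p : ℚ_[p]) ^ d' * MvPowerSeries.coeff e
        (g.subst (V.map PadicInt.Coe.ringHom).formalGroupLaw - g.subst (MvPowerSeries.X 0) -
          g.subst (MvPowerSeries.X 1))‖ ≤ 1) →
      ∃ (k : ℕ) (h : ℚ_[p]⟦X⟧), constantCoeff h = 0 ∧ IsPadicInt h ∧
        (V.map PadicInt.Coe.ringHom).formalLog.subst h = C ((p : ℚ_[p]) ^ k) * g)
    (hW3 : ∀ H : ℤ_[p]⟦X⟧, constantCoeff H = 0 →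
      (H.map PadicInt.toZMod).subst (V.map PadicInt.toZMod).formalGroupLaw =
        MvPowerSeries.subst ![(H.map PadicInt.toZMod).subst (MvPowerSeries.X 0 : MvPowerSeries (Fin 2) (ZMod p)),
          (H.map PadicInt.toZMod).subst (MvPowerSeries.X 1 : MvPowerSeries (Fin 2) (ZMod p))]
          (V.map PadicInt.toZMod).formalGroupLaw →
      ∃ (A B : ℤ_[p]) (H₁ : ℤ_[p]⟦X⟧),
        H₁.map PadicInt.Coe.ringHom = MvPowerSeries.subst
          ![(V.map PadicInt.Coe.ringHom).formalExp.subst (C (A : ℚ_[p]) * (V.map PadicInt.Coe.ringHom).formalLog),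
            expand p hp.out.ne_zero ((V.map PadicInt.Coe.ringHom).formalExp.subst
              (C (B : ℚ_[p]) * (V.map PadicInt.Coe.ringHom).formalLog))] (V.map PadicInt.Coe.ringHom).formalGroupLaw ∧
        H₁.map PadicInt.toZMod = H.map PadicInt.toZMod) :
    ∀ g : ℚ_[p]⟦X⟧, constantCoeff g = 0 →
      (∃ d : ℕ, ∀ n : ℕ, ‖(p : ℚ_[p]) ^ d * ((n : ℚ_[p]) * coeff n g)‖ ≤ 1) →
      (∃ d' : ℕ, ∀ e : Fin 2 →₀ ℕ, ‖(p : ℚ_[p]) ^ d' * MvPowerSeries.coeff e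
        (g.subst (V.map PadicInt.Coe.ringHom).formalGroupLaw - g.subst (MvPowerSeries.X 0) -
          g.subst (MvPowerSeries.X 1))‖ ≤ 1) →
      ∃ a b : ℚ_[p], ∃ d'' : ℕ, ∀ n : ℕ, ‖(p : ℚ_[p]) ^ d'' * coeff n
        (g - C a * (V.map PadicInt.Coe.ringHom).formalLog -
          C b * expand p hp.out.ne_zero (V.map PadicInt.Coe.ringHom).formalLog)‖ ≤ 1 := by
  set W := V.map (PadicInt.Coe.ringHom (p := p)) with hWdef
  haveI : W.IsIntegral ℤ_[p] := ⟨⟨V, rfl⟩⟩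
  have hp0 : (p : ℚ_[p]) ≠ 0 := by exact_mod_cast hp.out.ne_zero
  intro g hg0 hd hd'
  obtain ⟨k, h, h0, hint, hℓh⟩ := hW1 g hg0 hd hd'
  obtain ⟨d', hcob⟩ := hd'
  -- integral model `H` of `h`; `H̄ ∈ End(F̄)`
  obtain ⟨H, hH⟩ := isPadicInt_iff_exists_powerSeries_map.mp hint
  have hH0 : constantCoeff H = 0 := by
    apply (PadicInt.coe_eq_zero).mp
    have e := congrArg constantCoeff hH
    rw [← coeff_zero_eq_constantCoeff_apply, coeff_map, coeff_zero_eq_constantCoeff_apply] at e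
    rw [← h0]; exact e
  have hEnd := map_toZMod_subst_formalGroupLaw V hp2 hH0 (hH.symm ▸ hℓh) hcob
  obtain ⟨A, B, H₁, hH₁, hH₁r⟩ := hW3 H hH0 hEnd
  -- `h₁ = F([A]X, [B](Xᵖ))`, `h ≡ h₁ (mod p)`
  set h₁ := H₁.map (PadicInt.Coe.ringHom (p := p))
  have hA0 : constantCoeff (W.formalExp.subst (C (A : ℚ_[p]) * W.formalLog)) = 0 :=
    W.constantCoeff_formalExp_subst_C_mul_formalLog _
  have hB0 : constantCoeff (expand p hp.out.ne_zero (W.formalExp.subst (C (B : ℚ_[p]) * W.formalLog))) = 0 := by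
    rw [constantCoeff_expand]; exact W.constantCoeff_formalExp_subst_C_mul_formalLog _
  have h₁0 : constantCoeff h₁ = 0 := by
    rw [hH₁]
    exact MvPowerSeries.constantCoeff_subst_eq_zero (hasSubst_pair hA0 hB0) (constantCoeff_pair hA0 hB0)
      W.constantCoeff_formalGroupLaw
  have hint₁ : IsPadicInt h₁ := isPadicInt_map H₁
  have hc : IsPadicInt (C (p : ℚ_[p])⁻¹ * (h - h₁)) := by
    have hbar : (H - H₁).map (PadicInt.toZMod (p := p)) = 0 := by rw [map_sub, hH₁r, sub_self]
    have := FormalLogDivisibility.isPadicInt_inv_mul_of_map_toZMod_eq_zero (σ := Unit) (H - H₁) hbar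
    rw [map_sub] at this
    rw [← hH]
    exact this
  have hlog := isPadicInt_inv_mul_formalLog_subst_sub W h0 hint h₁0 hint₁ hc
  rw [hℓh, hH₁, formalLog_subst_pair_zmul_expand W] at hlog
  refine ⟨(A : ℚ_[p]) * ((p : ℚ_[p]) ^ k)⁻¹, (B : ℚ_[p]) * ((p : ℚ_[p]) ^ k)⁻¹, k, fun n => ?_⟩
  have hpk0 : (p : ℚ_[p]) ^ k ≠ 0 := pow_ne_zero _ hp0
  have e : (p : ℚ_[p]) ^ k * coeff n (g - C ((A : ℚ_[p]) * ((p : ℚ_[p]) ^ k)⁻¹) * W.formalLog -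
      C ((B : ℚ_[p]) * ((p : ℚ_[p]) ^ k)⁻¹) * expand p hp.out.ne_zero W.formalLog) =
      coeff n (C ((p : ℚ_[p]) ^ k) * g - (C (A : ℚ_[p]) * W.formalLog +
        C (B : ℚ_[p]) * expand p hp.out.ne_zero W.formalLog)) := by
    simp only [map_sub, map_add, coeff_C_mul]
    field_simp
    ring
  rw [e]
  have hn := (isPadicInt_iff_coeff.mp hlog) n
  rw [coeff_C_mul, norm_inv_mul_le_one_iff] at hn
  exact hn.trans (inv_le_one_of_one_le₀ (by exact_mod_cast hp.out.one_le))

end Assembly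

end Summit.BirchSwinnertonDyer.BirchSwinnertonDyer.Theorems.PadicRankTwoAssembly

end
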